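import Summits.BirchSwinnertonDyer.BirchSwinnertonDyer.Theorems.CyclotomicUntwistGNineCubicFrobeniusTrace
import Summits.BirchSwinnertonDyer.BirchSwinnertonDyer.Theorems.CyclotomicUntwistPSKrausC6Parity
import Summits.BirchSwinnertonDyer.BirchSwinnertonDyer.Theorems.CyclotomicUntwistGNineConverseNine
import Summits.BirchSwinnertonDyer.Rank1Residual.Additive.TypeGThreeUnitJ
import HarnessLib

/-!
# LAW L-a3 (N) AT THE W-LEVEL: on every principal-series row of K1/K2 the untwisted trace `a_w(W)`
# (`WeierstrassCurve.psUntwistedTrace`, closed form (N′)) IS the trace of Frobenius of `W ⊗ ℚ(ζ₉)` at the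
# place `w ∣ 3` (route `CyclotomicUntwist`, cruxes K1 `PSRankOneLowerHalfAtThree` / K2 `PSRankOneUpperHalfAtThree`)

Cell `pub/bsd-wall` (D-0145 line `route-BirchSwinnertonDyer-CyclotomicUntwist`), seat `bsd-line-cycu-p3`
(gen 7). Helper toward K1 (stmt-BirchSwinnertonDyer-21580) / K2 (stmt-21581). THEOREMS ONLY (no definition,
no named fact, no `sorry`); BSD is not proved by this file and no crux is. Route-independent (no `Theses`
import; the binders are spelled as in the route file).

This closes the item «NOT KERNEL: the W-level identity `psUntwistedTrace = frobeniusTraceAt (W ⊗ ℚ(ζ₉)) w`»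
of the lane memo `Cruxes/PSRankOneLowerHalfAtThree/LAW-La3-KERNEL-v4.md` §3/§6 (cycu-p3 g6): the closed form
(N′) of `CyclotomicUntwistPSUntwistedTraceDefs` (p616806), defined from `(c₆, Δ)` of any equation, is the
ARITHMETIC invariant it was designed to be. In the language of the pen's definition item
`defn-IsDescendedFrobeniusMatrix` (K-SEP texts of record, ruling 2026-08-28): for the crystalline Frobenius
`φ` of the special fibre `Ē_w` of `W ⊗ ℚ(ζ₉)` one has `tr φ = #k_w + 1 − #Ē_w(k_w) = a_w` (standard), so the
required API clause (t) `tr M = ↑W.psUntwistedTrace` reduces to the theorem below.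

* `natCard_quotient_eq_three` — the residue field of `ℚ(ζ₉)` (any `IsCyclotomicExtension {9} ℚ F`) at `w ∣ 3`
  has `3` elements (`𝔭_w = (ζ − 1)`, `N(ζ − 1) = 3`; Mathlib `absNorm_span_zeta_sub_one`);
* `twentySeven_dvd_c₄_of_not_potMult`, `kodairaSignature_P` — the W-side inputs of the cubic law: `27 ∣ c₄`
  for `v₃Δ_min ≥ 8` at a potentially good `3` (`ord₃ j ≥ 0`), and the Kraus/Papadopoulos middle entry
  (`PSTamagawaThree.padicValInt_c₆_of_classO6_of_even`: `v₃c₆ = 5` on IV, `8` on II*) read on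
  `P = 2b₂³ − 72b₂b₄ + 432b₆ = −2c₆`;
* **`frobeniusTraceAt_baseChange_eq_psUntwistedTrace`**: for `W/ℚ` elliptic, globally minimal, `ClassO6 W 3`,
  `v₃(Δ_min)` even, `Δ_min/3^v ≡ 1 (mod 3)` (the K1/K2 binders), every `F` with `IsCyclotomicExtension {9} ℚ F`
  and every place `w ∋ 3` of `F`: **`(W.baseChange F).frobeniusTraceAt w = W.psUntwistedTrace`**;
* `hasGoodReductionAt_baseChange_of_psRow` (good reduction at `w`, re-derived), `natCard_point_reductionAt_baseChange`
  (`#W̃_w(k_w) = 4 − a_w ∈ {1, 4, 7}`), `three_dvd_frobeniusTraceAt_baseChange` (SUPERSINGULAR good reduction),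
  `frobeniusTraceAt_baseChange_mem` (`a_w ∈ {0, ±3}`), `frobeniusTraceAt_baseChange_eq_zero_iff` (the `a_w = 0`
  third of the rows, K1-ROW-ATLAS: 133/416, is the `#Ē_w(𝔽₃) = 4` locus).

Proof: `W ⊗ F = E₀ ⊗ F` for the integral model `E₀`; the change `(1/2, 0, −a₁/2, −a₃/2)` (an isomorphism over
`F` and over `ℚ`) leads to the integer cubic `y² = x³ + b₂x² + 8b₄x + 16b₆` with `disc = 2⁸Δ_min = 3^v·d`,
`d ≡ 1 (mod 3)`, `3 ∣ b₂` (additive), to which the cubic-level law `GNineFrobeniusTrace.good_and_frobeniusTraceAt_cubic`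
applies; `a_w` is carried by `frobeniusTraceAt_smul` (Silverman VII.1.3(b)) and (N′) by
`psUntwistedTrace_variableChange` (p620627).

References: J. Tate, LNM 476 (1975) §7 [Tate1975]; A. Kraus, Manuscripta Math. 69 (1990), Théorème (p = 3)
[Kraus1990]; I. Papadopoulos, J. Number Theory 44 (1993) Table (p = 3) [Papadopoulos1993]; J. H. Silverman,
*AEC* VII.1 Prop. 1.3(b), VII.5.1(a), C.§16 [SilvermanAEC2009]; L. C. Washington, *Cyclotomic Fields*, Lemma 1.4
[Washington1997].
-/

-- single-conjunct summit: `Summit.BirchSwinnertonDyer.BirchSwinnertonDyer.…` repeats the name by design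
set_option linter.dupNamespace false
set_option autoImplicit false

noncomputable section

open scoped NumberField Classical

open IsDedekindDomain IsDedekindDomain.HeightOneSpectrum NumberField WeierstrassCurve WithZero
  Literature.NumberTheory.EllipticCurves Literature.NumberTheory.EllipticCurves.Rank1Residual
  Summit.BirchSwinnertonDyer.Rank1Residual.Additive
  Summit.BirchSwinnertonDyer.BirchSwinnertonDyer.Theorems.GNine

namespace Summit.BirchSwinnertonDyer.BirchSwinnertonDyer.Theorems.GNineFrobeniusTrace

/-! ### The residue field of `ℚ(ζ₉)` at `w ∣ 3` is `𝔽₃` -/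

section Place

variable {F : Type} [Field F] [NumberField F]

/-- **`#k_w = 3`** at the place `w ∣ 3` of a ninth cyclotomic field: `𝔭_w = (ζ − 1)` and `N(ζ − 1) = 3`.
[cite: Washington1997, Lemma 1.4] -/
theorem natCard_quotient_eq_three [hF : IsCyclotomicExtension {3 ^ (1 + 1)} ℚ F]
    (w : HeightOneSpectrum (𝓞 F)) (hw : (3 : 𝓞 F) ∈ w.asIdeal) : Nat.card (𝓞 F ⧸ w.asIdeal) = 3 := by
  haveI : Fact (Nat.Prime 3) := ⟨Nat.prime_three⟩
  rw [← Submodule.cardQuot_apply, ← Ideal.absNorm_apply, GNineConverse.asIdeal_eq_span_zeta_sub_one w hw]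
  exact_mod_cast IsCyclotomicExtension.Rat.absNorm_span_zeta_sub_one 3 1
    (IsCyclotomicExtension.zeta_spec (3 ^ (1 + 1)) ℚ F)

end Place

/-! ### W-side inputs of the cubic law -/

section Inputs

variable (W : WeierstrassCurve ℚ) [W.IsElliptic] [W.IsGloballyMinimal]

/-- **`27 ∣ c₄`** on the integral model when `v₃Δ_min ≥ 7` at a potentially good `3` (`ord₃ j ≥ 0`:
`3·ord₃ c₄ ≥ ord₃ Δ_min`; the route-independent form of `GNineCriterion.pow_dvd_c₄_of_not_potMult` with `k = 3`).
[cite: SilvermanAEC2009, VII.5 Prop. 5.5 (potential good reduction ⟺ j integral)] -/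
theorem twentySeven_dvd_c₄_of_not_potMult (hpm : ¬ PotMult W 3)
    (hv : 7 ≤ padicValInt 3 (integralModelInt W).Δ) : (27 : ℤ) ∣ (integralModelInt W).c₄ := by
  haveI : Fact (Nat.Prime 3) := ⟨Nat.prime_three⟩
  by_cases hc0 : (integralModelInt W).c₄ = 0
  · rw [hc0]; exact dvd_zero _
  have hc : W.c₄ = ((integralModelInt W).c₄ : ℚ) :=
    Summit.BirchSwinnertonDyer.BirchSwinnertonDyer.Rank1Residual.IntModel.c₄_eq_cast rfl
  have hΔ : W.Δ = ((integralModelInt W).Δ : ℚ) :=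
    Summit.BirchSwinnertonDyer.BirchSwinnertonDyer.Rank1Residual.IntModel.Δ_eq_cast rfl
  have hΔ0 : (integralModelInt W).Δ ≠ 0 := minimalDiscriminantInt_ne_zero W
  have hjq : W.j = W.c₄ ^ 3 / W.Δ := by
    rw [WeierstrassCurve.j, ← coe_Δ', div_eq_inv_mul, Units.val_inv_eq_inv_val]
  have hj : 0 ≤ padicValRat 3 W.j := not_lt.mp hpm
  rw [hjq, hc, hΔ, padicValRat.div (pow_ne_zero _ (by exact_mod_cast hc0)) (by exact_mod_cast hΔ0),
    padicValRat.pow, padicValRat.of_int, padicValRat.of_int] at hj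
  rw [show (27 : ℤ) = 3 ^ 3 by norm_num, three_pow_dvd_iff]
  right
  push_cast at hj
  omega

omit [W.IsElliptic] [W.IsGloballyMinimal] in
/-- `P = 2b₂³ − 9b₂(8b₄) + 27(16b₆) = −2·c₆` on any model (Silverman III.1: `c₆ = −b₂³ + 36b₂b₄ − 216b₆`).
[cite: SilvermanAEC2009, III.1] -/
theorem csix_of_b {R : Type*} [CommRing R] (E₀ : WeierstrassCurve R) :
    2 * E₀.b₂ ^ 3 - 9 * E₀.b₂ * (8 * E₀.b₄) + 27 * (16 * E₀.b₆) = -2 * E₀.c₆ := by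
  simp only [WeierstrassCurve.c₆]; ring

omit [W.IsElliptic] [W.IsGloballyMinimal] in
/-- `v₃ c = n ≠ 0` gives `3ⁿ ∥ −2c`. [folklore] -/
theorem pow_dvd_neg_two_mul_of_padicValInt {c : ℤ} {n : ℕ} (hn : n ≠ 0) (h : padicValInt 3 c = n) :
    (3 : ℤ) ^ n ∣ -2 * c ∧ ¬ (3 : ℤ) ^ (n + 1) ∣ -2 * c := by
  have hc0 : c ≠ 0 := by rintro rfl; simp at h; exact hn h.symm
  constructor
  · exact Dvd.dvd.mul_left ((three_pow_dvd_iff n c).mpr (Or.inr h.ge)) _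
  · intro hd
    have hcop : IsCoprime ((3 : ℤ) ^ (n + 1)) (-2) := (show IsCoprime (3 : ℤ) (-2) from ⟨1, 1, by norm_num⟩).pow_left
    have h' : (3 : ℤ) ^ (n + 1) ∣ c := hcop.dvd_of_dvd_mul_left hd
    rcases (three_pow_dvd_iff (n + 1) c).mp h' with h0 | hle
    · exact hc0 h0
    · omega

/-- **The Kodaira IV / II* signature on `P = −2c₆`** for a class-O6 curve at `3` with `v₃Δ_min` even:
`v₃Δ_min = 6 ⟹ 3⁵ ∥ P` and `v₃Δ_min = 12 ⟹ 3⁸ ∥ P` (Papadopoulos' middle entries `v₃c₆ = 5, 8`, as proved in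
`PSTamagawaThree.padicValInt_c₆_of_classO6_of_even`); also `v₃Δ_min ∈ {4, 6, 10, 12}`.
[cite: Papadopoulos1993, Table (p = 3)] [cite: Kraus1990, Théorème (p = 3)] -/
theorem kodairaSignature_P (hO6 : ClassO6 W 3) (hev : Even (padicValInt 3 W.minimalDiscriminantInt)) :
    (padicValInt 3 (integralModelInt W).Δ = 4 ∨ padicValInt 3 (integralModelInt W).Δ = 6 ∨
      padicValInt 3 (integralModelInt W).Δ = 10 ∨ padicValInt 3 (integralModelInt W).Δ = 12) ∧
    (padicValInt 3 (integralModelInt W).Δ = 6 →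
      (3 : ℤ) ^ 5 ∣ -2 * (integralModelInt W).c₆ ∧ ¬ (3 : ℤ) ^ 6 ∣ -2 * (integralModelInt W).c₆) ∧
    (padicValInt 3 (integralModelInt W).Δ = 12 →
      (3 : ℤ) ^ 8 ∣ -2 * (integralModelInt W).c₆ ∧ ¬ (3 : ℤ) ^ 9 ∣ -2 * (integralModelInt W).c₆) := by
  have hmin : W.minimalDiscriminantInt = (integralModelInt W).Δ := rfl
  have h := PSTamagawaThree.padicValInt_c₆_of_classO6_of_even W hO6 hev
  rw [hmin] at h
  refine ⟨?_, fun h6 ↦ ?_, fun h12 ↦ ?_⟩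
  · rcases h with ⟨h, -⟩ | ⟨h, -⟩ | ⟨h, -⟩ | ⟨h, -⟩ <;> omega
  · rcases h with ⟨h, -⟩ | ⟨-, h5⟩ | ⟨h, -⟩ | ⟨h, -⟩
    · omega
    · exact pow_dvd_neg_two_mul_of_padicValInt (by norm_num) h5
    · omega
    · omega
  · rcases h with ⟨h, -⟩ | ⟨h, -⟩ | ⟨h, -⟩ | ⟨-, h8⟩
    · omega
    · omega
    · omega
    · exact pow_dvd_neg_two_mul_of_padicValInt (by norm_num) h8

end Inputs

/-! ### The W-level law -/

section Main

variable (W : WeierstrassCurve ℚ) [W.IsElliptic] [W.IsGloballyMinimal]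

/-- **LAW L-a3 (N) at the W-level: good reduction and `a_w = psUntwistedTrace`.** For `W/ℚ` elliptic and
globally minimal on a principal-series row at `3` (`ClassO6 W 3`, `v₃(Δ_min)` even, `Δ_min/3^v ≡ 1 (mod 3)`),
every ninth cyclotomic field `F` (`IsCyclotomicExtension {9} ℚ F`) and every place `w ∋ 3` of `F`:
`W ⊗ F` has good reduction at `w` and `(W ⊗ F).frobeniusTraceAt w = W.psUntwistedTrace`.
[cite: Kraus1990, Théorème (p = 3)] [cite: Tate1975, §7] [cite: SilvermanAEC2009, VII.1 Prop. 1.3(b) and C.§16] -/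
theorem good_and_frobeniusTraceAt_baseChange_of_psRow (hO6 : ClassO6 W 3)
    (hev : Even (padicValInt 3 W.minimalDiscriminantInt))
    (hsq : W.minimalDiscriminantInt / 3 ^ padicValInt 3 W.minimalDiscriminantInt % 3 = 1)
    (F : Type) [Field F] [NumberField F] [IsCyclotomicExtension {9} ℚ F]
    (w : HeightOneSpectrum (𝓞 F)) (hw : (3 : 𝓞 F) ∈ w.asIdeal) :
    (W.baseChange F).HasGoodReductionAt w ∧ (W.baseChange F).frobeniusTraceAt w = W.psUntwistedTrace := by
  haveI hp3 : Fact (Nat.Prime 3) := ⟨Nat.prime_three⟩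
  have hadd : Addv W 3 := hO6.2.1
  have hpm : ¬ PotMult W 3 := hO6.2.2.1
  obtain ⟨hvals, hP6, hP12⟩ := kodairaSignature_P W hO6 hev
  have hc4W : 7 ≤ padicValInt 3 (integralModelInt W).Δ → (27 : ℤ) ∣ (integralModelInt W).c₄ :=
    twentySeven_dvd_c₄_of_not_potMult W hpm
  -- integer data (as in `GNineCriterion.typeGNine_of_square_minimalDiscriminant`)
  set E₀ : WeierstrassCurve ℤ := integralModelInt W with hE₀
  set A : ℤ := E₀.b₂ with hA
  set B : ℤ := 8 * E₀.b₄ with hB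
  set C : ℤ := 16 * E₀.b₆ with hC
  set v : ℕ := padicValInt 3 E₀.Δ with hvdef
  have hmin : W.minimalDiscriminantInt = E₀.Δ := rfl
  rw [hmin] at hev hsq
  have hc4E : E₀.c₄ = A ^ 2 - 3 * B := c₄_eq_b₂_sq_sub E₀
  have hDE : A ^ 2 * B ^ 2 - 4 * B ^ 3 - 4 * A ^ 3 * C - 27 * C ^ 2 + 18 * A * B * C =
      256 * E₀.Δ := disc_b_eq E₀
  have hPE : 2 * A ^ 3 - 9 * A * B + 27 * C = -2 * E₀.c₆ := csix_of_b E₀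
  have hΔ0 : E₀.Δ ≠ 0 := minimalDiscriminantInt_ne_zero W
  have h3c4 : (3 : ℤ) ∣ A ^ 2 - 3 * B := hc4E ▸ three_dvd_c₄_of_addv W hadd
  have h3A : (3 : ℤ) ∣ A := by
    have : (3 : ℤ) ∣ A ^ 2 := by
      have := dvd_add h3c4 (dvd_mul_right 3 B)
      simpa using this
    exact Int.prime_three.dvd_of_dvd_pow this
  have hv1 : 1 ≤ v := by rcases hvals with h | h | h | h <;> omega
  have hv13 : v ≤ 13 := by rcases hvals with h | h | h | h <;> omega
  -- `E₀.Δ = 3^v · d₀` with `d₀ % 3 = 1`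
  obtain ⟨d₀, hd₀⟩ : (3 : ℤ) ^ v ∣ E₀.Δ := (three_pow_dvd_iff v E₀.Δ).mpr (Or.inr le_rfl)
  have hd₀' : E₀.Δ / 3 ^ v = d₀ := by
    rw [hd₀, Int.mul_ediv_cancel_left _ (pow_ne_zero _ (by norm_num))]
  rw [hd₀'] at hsq
  have hD : A ^ 2 * B ^ 2 - 4 * B ^ 3 - 4 * A ^ 3 * C - 27 * C ^ 2 + 18 * A * B * C =
      3 ^ v * (256 * d₀) := by rw [hDE, hd₀]; ring
  have hd : 256 * d₀ % 3 = 1 := by omega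
  have hc4 : 8 ≤ v → (27 : ℤ) ∣ A ^ 2 - 3 * B := fun h8 ↦ by
    rw [← hc4E]; exact hc4W (by omega)
  have hP6' : v = 6 → (3 : ℤ) ^ 5 ∣ 2 * A ^ 3 - 9 * A * B + 27 * C ∧
      ¬ (3 : ℤ) ^ 6 ∣ 2 * A ^ 3 - 9 * A * B + 27 * C := fun h ↦ by rw [hPE]; exact hP6 h
  have hP12' : v = 12 → (3 : ℤ) ^ 8 ∣ 2 * A ^ 3 - 9 * A * B + 27 * C ∧
      ¬ (3 : ℤ) ^ 9 ∣ 2 * A ^ 3 - 9 * A * B + 27 * C := fun h ↦ by rw [hPE]; exact hP12 h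
  -- the field data
  haveI hcycF : IsCyclotomicExtension {3 ^ (1 + 1)} ℚ F := by
    simpa using (inferInstance : IsCyclotomicExtension {9} ℚ F)
  set ζ : F := IsCyclotomicExtension.zeta (3 ^ (1 + 1)) ℚ F with hζdef
  have hζ' : IsPrimitiveRoot ζ (3 ^ (1 + 1)) := IsCyclotomicExtension.zeta_spec (3 ^ (1 + 1)) ℚ F
  have hζ : IsPrimitiveRoot ζ 9 := by norm_num at hζ'; exact hζ'
  have hq : Nat.card (𝓞 F ⧸ w.asIdeal) = 3 := natCard_quotient_eq_three w hw
  -- the cubic-level law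
  obtain ⟨hgoodC, htrC⟩ := good_and_frobeniusTraceAt_cubic w hζ hw hq A B C v (256 * d₀) h3A hD hd
    hev hv1 hv13 hc4 hP6' hP12'
  -- `W ⊗ F = E₀ ⊗ F`, and the cubic model is `(1/2, 0, −a₁/2, −a₃/2) • (E₀ ⊗ F)`
  have hWF : W.baseChange F = E₀.map (Int.castRingHom F) := by
    conv_lhs => rw [← map_integralModelInt W]
    rw [baseChange, map_map]
    congr 1
    exact RingHom.ext_int _ _
  have h2F : (2 : F) ≠ 0 := two_ne_zero
  have hcubF : (⟨Units.mk0 (2 : F)⁻¹ (inv_ne_zero h2F), 0, -(E₀.map (Int.castRingHom F)).a₁ / 2,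
      -(E₀.map (Int.castRingHom F)).a₃ / 2⟩ : VariableChange F) • E₀.map (Int.castRingHom F) =
      ⟨0, ((A : ℤ) : F), 0, ((B : ℤ) : F), ((C : ℤ) : F)⟩ := by
    rw [cubicModel_smul h2F, map_b₂, map_b₄, map_b₆, hA, hB, hC]
    ext <;> simp
  haveI hEF : (E₀.map (Int.castRingHom F)).IsElliptic := by
    rw [← hWF, WeierstrassCurve.baseChange]; infer_instance
  have hgoodE : (E₀.map (Int.castRingHom F)).HasGoodReductionAt w :=
    (hasGoodReductionAt_smul_iff_holds w (E₀.map (Int.castRingHom F)) _).mp (hcubF ▸ hgoodC)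
  refine ⟨hWF ▸ hgoodE, ?_⟩
  rw [hWF, ← WeierstrassCurve.frobeniusTraceAt_smul (E₀.map (Int.castRingHom F)) _ w hgoodE, hcubF, htrC]
  -- the `ℚ`-side: `psUntwistedTrace` of the cubic is that of `E₀ ⊗ ℚ = W`
  have h2Q : (2 : ℚ) ≠ 0 := two_ne_zero
  have hcubQ : (⟨Units.mk0 (2 : ℚ)⁻¹ (inv_ne_zero h2Q), 0, -(E₀.map (Int.castRingHom ℚ)).a₁ / 2,
      -(E₀.map (Int.castRingHom ℚ)).a₃ / 2⟩ : VariableChange ℚ) • E₀.map (Int.castRingHom ℚ) =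
      (⟨0, A, 0, B, C⟩ : WeierstrassCurve ℤ).map (Int.castRingHom ℚ) := by
    rw [cubicModel_smul h2Q, map_b₂, map_b₄, map_b₆, hA, hB, hC, cubic_map]
    ext <;> simp
  have hΔQ : (E₀.map (Int.castRingHom ℚ)).Δ ≠ 0 := by
    rw [map_Δ, eq_intCast]; exact_mod_cast hΔ0
  rw [← hcubQ, PSUntwistedTrace.psUntwistedTrace_variableChange _ _ hΔQ, hE₀, map_integralModelInt]

/-- **LAW L-a3 (N) at the W-level.** For `W/ℚ` elliptic, globally minimal, on a principal-series row at `3`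
(`ClassO6 W 3`, `v₃(Δ_min)` even, `Δ_min/3^v ≡ 1 (mod 3)` — the binders of K1 `PSRankOneLowerHalfAtThree` /
K2 `PSRankOneUpperHalfAtThree`), every ninth cyclotomic field `F` and every place `w ∋ 3` of `F`:
**`(W ⊗ F).frobeniusTraceAt w = W.psUntwistedTrace`** — the untwisted trace `a_w ∈ {0, ±3}` of LAW L-a3 is
the trace of Frobenius of the (good, supersingular) reduction of `E` over `ℚ(ζ₉)` at `w`.
[cite: Kraus1990, Théorème (p = 3)] [cite: Tate1975, §7] [cite: SilvermanAEC2009, C.§16] -/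
theorem frobeniusTraceAt_baseChange_eq_psUntwistedTrace (hO6 : ClassO6 W 3)
    (hev : Even (padicValInt 3 W.minimalDiscriminantInt))
    (hsq : W.minimalDiscriminantInt / 3 ^ padicValInt 3 W.minimalDiscriminantInt % 3 = 1)
    (F : Type) [Field F] [NumberField F] [IsCyclotomicExtension {9} ℚ F]
    (w : HeightOneSpectrum (𝓞 F)) (hw : (3 : 𝓞 F) ∈ w.asIdeal) :
    (W.baseChange F).frobeniusTraceAt w = W.psUntwistedTrace :=
  (good_and_frobeniusTraceAt_baseChange_of_psRow W hO6 hev hsq F w hw).2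

/-- Good reduction of `W ⊗ F` at `w ∣ 3` on the principal-series rows (the content of `TypeGNine` at this
place, re-derived route-independently). [cite: Kraus1990, Théorème (p = 3)] -/
theorem hasGoodReductionAt_baseChange_of_psRow (hO6 : ClassO6 W 3)
    (hev : Even (padicValInt 3 W.minimalDiscriminantInt))
    (hsq : W.minimalDiscriminantInt / 3 ^ padicValInt 3 W.minimalDiscriminantInt % 3 = 1)
    (F : Type) [Field F] [NumberField F] [IsCyclotomicExtension {9} ℚ F]
    (w : HeightOneSpectrum (𝓞 F)) (hw : (3 : 𝓞 F) ∈ w.asIdeal) :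
    (W.baseChange F).HasGoodReductionAt w :=
  (good_and_frobeniusTraceAt_baseChange_of_psRow W hO6 hev hsq F w hw).1

/-- **`#W̃_w(k_w) = 4 − a_w(W)`** (`∈ {1, 4, 7}`; `k_w = 𝔽₃`). [cite: SilvermanAEC2009, C.§16 and V.2] -/
theorem natCard_point_reductionAt_baseChange (hO6 : ClassO6 W 3)
    (hev : Even (padicValInt 3 W.minimalDiscriminantInt))
    (hsq : W.minimalDiscriminantInt / 3 ^ padicValInt 3 W.minimalDiscriminantInt % 3 = 1)
    (F : Type) [Field F] [NumberField F] [IsCyclotomicExtension {9} ℚ F]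
    (w : HeightOneSpectrum (𝓞 F)) (hw : (3 : 𝓞 F) ∈ w.asIdeal) :
    (Nat.card ((W.baseChange F).reductionAt w).toAffine.Point : ℤ) = 4 - W.psUntwistedTrace := by
  haveI : IsCyclotomicExtension {3 ^ (1 + 1)} ℚ F := by
    simpa using (inferInstance : IsCyclotomicExtension {9} ℚ F)
  have h := frobeniusTraceAt_baseChange_eq_psUntwistedTrace W hO6 hev hsq F w hw
  rw [frobeniusTraceAt_def, IsDedekindDomain.HeightOneSpectrum.natCard_residueField_adicCompletionIntegers F w,
    natCard_quotient_eq_three w hw] at h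
  simp only [Nat.cast_ofNat] at h
  linarith

/-- **Supersingular**: `3 ∣ a_w(W ⊗ F)` on the principal-series rows (`3 ∣ psUntwistedTrace`, p616806).
[cite: SilvermanAEC2009, V.4 (j = 0 in characteristic 3)] -/
theorem three_dvd_frobeniusTraceAt_baseChange (hO6 : ClassO6 W 3)
    (hev : Even (padicValInt 3 W.minimalDiscriminantInt))
    (hsq : W.minimalDiscriminantInt / 3 ^ padicValInt 3 W.minimalDiscriminantInt % 3 = 1)
    (F : Type) [Field F] [NumberField F] [IsCyclotomicExtension {9} ℚ F]
    (w : HeightOneSpectrum (𝓞 F)) (hw : (3 : 𝓞 F) ∈ w.asIdeal) :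
    (3 : ℤ) ∣ (W.baseChange F).frobeniusTraceAt w := by
  rw [frobeniusTraceAt_baseChange_eq_psUntwistedTrace W hO6 hev hsq F w hw]
  exact PSUntwistedTrace.three_dvd_psUntwistedTrace W

/-- `a_w(W ⊗ F) ∈ {0, 3, −3}`. [cite: SilvermanAEC2009, V.2] -/
theorem frobeniusTraceAt_baseChange_mem (hO6 : ClassO6 W 3)
    (hev : Even (padicValInt 3 W.minimalDiscriminantInt))
    (hsq : W.minimalDiscriminantInt / 3 ^ padicValInt 3 W.minimalDiscriminantInt % 3 = 1)
    (F : Type) [Field F] [NumberField F] [IsCyclotomicExtension {9} ℚ F]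
    (w : HeightOneSpectrum (𝓞 F)) (hw : (3 : 𝓞 F) ∈ w.asIdeal) :
    (W.baseChange F).frobeniusTraceAt w = 0 ∨ (W.baseChange F).frobeniusTraceAt w = 3 ∨
      (W.baseChange F).frobeniusTraceAt w = -3 := by
  rw [frobeniusTraceAt_baseChange_eq_psUntwistedTrace W hO6 hev hsq F w hw]
  exact PSUntwistedTrace.psUntwistedTrace_eq_or W

/-- **The `a_w = 0` third of the rows**: `a_w(W ⊗ F) = 0 ⟺ W.psUntwistedTrace = 0` (decidable on `Δ′`, `c₆ᵘ`
by p617540's `psUntwistedTrace_eq_zero_iff_*`), i.e. `#W̃_w(𝔽₃) = 4`. [cite: Kraus1990, Théorème (p = 3)] -/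
theorem frobeniusTraceAt_baseChange_eq_zero_iff (hO6 : ClassO6 W 3)
    (hev : Even (padicValInt 3 W.minimalDiscriminantInt))
    (hsq : W.minimalDiscriminantInt / 3 ^ padicValInt 3 W.minimalDiscriminantInt % 3 = 1)
    (F : Type) [Field F] [NumberField F] [IsCyclotomicExtension {9} ℚ F]
    (w : HeightOneSpectrum (𝓞 F)) (hw : (3 : 𝓞 F) ∈ w.asIdeal) :
    (W.baseChange F).frobeniusTraceAt w = 0 ↔ W.psUntwistedTrace = 0 := by
  rw [frobeniusTraceAt_baseChange_eq_psUntwistedTrace W hO6 hev hsq F w hw]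

end Main

end Summit.BirchSwinnertonDyer.BirchSwinnertonDyer.Theorems.GNineFrobeniusTrace

end
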